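import Summits.CriticalPhenomena.PercolationContinuityZ3.Theorems.PercNearOneGluingNoHeavyLowerTailSahiE3ExchangeCross
import Mathlib.Tactic.Linarith
import Mathlib.Tactic.Ring
import Mathlib.Tactic.Positivity
import HarnessLib
import HarnessLib.Audit

/-!
# `NoHeavyLowerTail` (crux stmt-CriticalPhenomena-4575), Sahi programme P4: the 2×2 exchange lemma (GENERAL configuration class) — the FULL-SLOT case

Support file (cell `prim-l12`, seat P4, generation 28; `--supports stmt-CriticalPhenomena-4575`).  No named facts, no sorries;
standard axioms; def-free.

Context (HOME prim-l12-p4/FROM-prim-l12-p4-gen28-*.md; `…SahiE3ExchangeCross` for the statement).  Harris block `(B, w, V)` (`w ≥ 0` of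
mass `1`, slot `V`, `v = w(V)`, `a(X) = w(X∩V)`, `need(X,Y) = x·a(Y) + y·a(X) − v·x·y`), GENERAL configuration `O ⊆ K∩L`, `K∪L ⊆ P`,
`O' ⊆ K'∩L'`, `K'∪L' ⊆ P'` and a weight `R` satisfying the pair inequality at the SAME-INDEX pairs `(K,K')`, `(L,L')` (always an admissible
packing of the supply `R(KK'V) + R(LL'V)`).  FULL SLOT: `P ∪ P' ⊆ V`.  Then every slot-trace is the set itself, `need(X,Y) = (2−v)·xy` on the
configuration, and both bracket shapes of the exchange expression (generation 20, `exchange_of_noCross₂/₁`) are bounded below by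
`(2−v)·Har(P,P') + Har(O,O') + [(p−o)(p'−o') + (1−v)·(products) − (2−v)(k−l)(l'−k')] ≥ (2−v)·Har(P,P') + Har(O,O') ≥ 0`
(`exchange_fullSlot₂`, `exchange_fullSlot₁`; the bracket is `≥ 0` by `|k−l| ≤ p−o`, `|l'−k'| ≤ p'−o'`, `fullSlot_core₂/₁`).  This extends
generation 20's paper remark for `V = B` and generation 28's pure-class `…SahiE3ExchangeJoin.exchange_pure_of_subset_slot` to the whole
configuration class: the first certificate-free, crossing-agnostic case of the general exchange lemma. [this work]
-/

namespace Summit.CriticalPhenomena.PercolationContinuityZ3.Theorems.SahiE3ExchangeFullSlot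

open Finset SahiE3DimerPacking SahiE3ExchangeCross
open scoped BigOperators

/-- Algebraic core, bracket 2: for `o ≤ k, l ≤ p`, `o' ≤ k', l' ≤ p'` and `0 ≤ u` (`u = 1 − v`):
`(p−o)(p'−o') + u·[(p−k)(p'−l') + (p−l)(p'−k')] ≥ (1+u)·(k−l)(l'−k')`. [this work] -/
theorem fullSlot_core₂ (p o k l p' o' k' l' u : ℝ) (hok : o ≤ k) (hol : o ≤ l) (hkp : k ≤ p) (hlp : l ≤ p)
    (hok' : o' ≤ k') (hol' : o' ≤ l') (hkp' : k' ≤ p') (hlp' : l' ≤ p') (hu : 0 ≤ u) :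
    (1 + u) * ((k - l) * (l' - k')) ≤ (p - o) * (p' - o') + u * ((p - k) * (p' - l') + (p - l) * (p' - k')) := by
  have h1 : 0 ≤ u * ((p - k) * (p' - l')) := mul_nonneg hu (mul_nonneg (by linarith) (by linarith))
  have h2 : 0 ≤ u * ((p - l) * (p' - k')) := mul_nonneg hu (mul_nonneg (by linarith) (by linarith))
  have h3 : 0 ≤ (p - o) * (p' - o') := mul_nonneg (by linarith) (by linarith)
  rcases le_total l k with hlk | hkl
  · rcases le_total k' l' with hk'l' | hl'k'
    · -- (k−l)(l'−k') ≥ 0: use (p−o)(p'−o') ≥ (k−l)(l'−k') and (p−l)(p'−k') ≥ (k−l)(l'−k')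
      have e1 : (k - l) * (l' - k') ≤ (p - o) * (p' - o') :=
        mul_le_mul (by linarith) (by linarith) (by linarith) (by linarith)
      have e2 : (k - l) * (l' - k') ≤ (p - l) * (p' - k') :=
        mul_le_mul (by linarith) (by linarith) (by linarith) (by linarith)
      have e3 : u * ((k - l) * (l' - k')) ≤ u * ((p - l) * (p' - k')) := mul_le_mul_of_nonneg_left e2 hu
      nlinarith
    · have e0 : (k - l) * (l' - k') ≤ 0 := mul_nonpos_of_nonneg_of_nonpos (by linarith) (by linarith)
      nlinarith
  · rcases le_total k' l' with hk'l' | hl'k'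
    · have e0 : (k - l) * (l' - k') ≤ 0 := mul_nonpos_of_nonpos_of_nonneg (by linarith) (by linarith)
      nlinarith
    · -- (k−l)(l'−k') = (l−k)(k'−l') ≥ 0: use (p−o)(p'−o') ≥ (l−k)(k'−l') and (p−k)(p'−l') ≥ (l−k)(k'−l')
      have e1 : (l - k) * (k' - l') ≤ (p - o) * (p' - o') :=
        mul_le_mul (by linarith) (by linarith) (by linarith) (by linarith)
      have e2 : (l - k) * (k' - l') ≤ (p - k) * (p' - l') :=
        mul_le_mul (by linarith) (by linarith) (by linarith) (by linarith)
      have e3 : u * ((l - k) * (k' - l')) ≤ u * ((p - k) * (p' - l')) := mul_le_mul_of_nonneg_left e2 hu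
      nlinarith

/-- Algebraic core, bracket 1: same ranges;
`(p−o)(p'−o') + u·[(p−k)(k'−o') + (p−o)(p'−k')] ≥ (1+u)·(k−l)(l'−k')`. [this work] -/
theorem fullSlot_core₁ (p o k l p' o' k' l' u : ℝ) (hok : o ≤ k) (hol : o ≤ l) (hkp : k ≤ p) (hlp : l ≤ p)
    (hok' : o' ≤ k') (hol' : o' ≤ l') (hkp' : k' ≤ p') (hlp' : l' ≤ p') (hu : 0 ≤ u) :
    (1 + u) * ((k - l) * (l' - k')) ≤ (p - o) * (p' - o') + u * ((p - k) * (k' - o') + (p - o) * (p' - k')) := by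
  have h1 : 0 ≤ u * ((p - k) * (k' - o')) := mul_nonneg hu (mul_nonneg (by linarith) (by linarith))
  have h2 : 0 ≤ u * ((p - o) * (p' - k')) := mul_nonneg hu (mul_nonneg (by linarith) (by linarith))
  have h3 : 0 ≤ (p - o) * (p' - o') := mul_nonneg (by linarith) (by linarith)
  rcases le_total l k with hlk | hkl
  · rcases le_total k' l' with hk'l' | hl'k'
    · have e1 : (k - l) * (l' - k') ≤ (p - o) * (p' - o') :=
        mul_le_mul (by linarith) (by linarith) (by linarith) (by linarith)
      have e2 : (k - l) * (l' - k') ≤ (p - o) * (p' - k') :=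
        mul_le_mul (by linarith) (by linarith) (by linarith) (by linarith)
      have e3 : u * ((k - l) * (l' - k')) ≤ u * ((p - o) * (p' - k')) := mul_le_mul_of_nonneg_left e2 hu
      nlinarith
    · have e0 : (k - l) * (l' - k') ≤ 0 := mul_nonpos_of_nonneg_of_nonpos (by linarith) (by linarith)
      nlinarith
  · rcases le_total k' l' with hk'l' | hl'k'
    · have e0 : (k - l) * (l' - k') ≤ 0 := mul_nonpos_of_nonpos_of_nonneg (by linarith) (by linarith)
      nlinarith
    · have e1 : (l - k) * (k' - l') ≤ (p - o) * (p' - o') :=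
        mul_le_mul (by linarith) (by linarith) (by linarith) (by linarith)
      have e2 : (l - k) * (k' - l') ≤ (p - k) * (k' - o') :=
        mul_le_mul (by linarith) (by linarith) (by linarith) (by linarith)
      have e3 : u * ((l - k) * (k' - l')) ≤ u * ((p - k) * (k' - o')) := mul_le_mul_of_nonneg_left e2 hu
      nlinarith

variable {B : Type*} [DecidableEq B]

/-- **Exchange lemma, general class, FULL SLOT, bracket 2.**  `B` finite, `w ≥ 0` of mass `1`, slot `V ⊇ P ∪ P'`, configuration
`O ⊆ K∩L`, `K∪L ⊆ P`, `O' ⊆ K'∩L'`, `K'∪L' ⊆ P'`, a weight `R` satisfying the pair inequality at `(K,K')` and at `(L,L')`, and the Harris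
products `Har(P,P')`, `Har(O,O') ≥ 0`.  Then the bracket-2 exchange expression of `…SahiE3ExchangeCross.exchange_of_noCross₂` is `≥ 0`,
whatever the crossing cells are. [this work] -/
theorem exchange_fullSlot₂ [Fintype B] (w R : B → ℝ) (hw : ∀ b, 0 ≤ w b) (hw1 : ∑ b, w b = 1)
    (V K L P O K' L' P' O' : Finset B)
    (hOK : O ⊆ K) (hOL : O ⊆ L) (hKP : K ⊆ P) (hLP : L ⊆ P) (hOK' : O' ⊆ K') (hOL' : O' ⊆ L') (hKP' : K' ⊆ P') (hLP' : L' ⊆ P')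
    (hPV : P ⊆ V) (hP'V : P' ⊆ V)
    (hpairK : (∑ b ∈ K, w b) * (∑ b ∈ K' ∩ V, w b) + (∑ b ∈ K', w b) * (∑ b ∈ K ∩ V, w b)
        - (∑ b ∈ V, w b) * (∑ b ∈ K, w b) * (∑ b ∈ K', w b) ≤ ∑ b ∈ (K ∩ K') ∩ V, R b)
    (hpairL : (∑ b ∈ L, w b) * (∑ b ∈ L' ∩ V, w b) + (∑ b ∈ L', w b) * (∑ b ∈ L ∩ V, w b)
        - (∑ b ∈ V, w b) * (∑ b ∈ L, w b) * (∑ b ∈ L', w b) ≤ ∑ b ∈ (L ∩ L') ∩ V, R b)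
    (hHarPP' : (∑ b ∈ P, w b) * (∑ b ∈ P', w b) ≤ ∑ b ∈ P ∩ P', w b)
    (hHarOO' : (∑ b ∈ O, w b) * (∑ b ∈ O', w b) ≤ ∑ b ∈ O ∩ O', w b) :
    0 ≤ (∑ b ∈ (P ∩ P') ∩ V, w b) + (∑ b ∈ (O ∩ O') ∩ V, w b)
        - (∑ b ∈ P, w b) * (∑ b ∈ O' ∩ V, w b) - (∑ b ∈ P', w b) * (∑ b ∈ O ∩ V, w b)
        + (∑ b ∈ (K ∩ K') ∩ V, R b) + (∑ b ∈ (L ∩ L') ∩ V, R b)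
        - ((∑ b ∈ K, w b) * (∑ b ∈ L' ∩ V, w b) + (∑ b ∈ L', w b) * (∑ b ∈ K ∩ V, w b)
            - (∑ b ∈ V, w b) * (∑ b ∈ K, w b) * (∑ b ∈ L', w b))
        - ((∑ b ∈ L, w b) * (∑ b ∈ K' ∩ V, w b) + (∑ b ∈ K', w b) * (∑ b ∈ L ∩ V, w b)
            - (∑ b ∈ V, w b) * (∑ b ∈ L, w b) * (∑ b ∈ K', w b))
        + (1 - ∑ b ∈ V, w b) * ((∑ b ∈ P ∩ P', w b) - (∑ b ∈ P, w b) * (∑ b ∈ P', w b)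
            + ((∑ b ∈ P, w b) - ∑ b ∈ K, w b) * ((∑ b ∈ P', w b) - ∑ b ∈ L', w b)
            + ((∑ b ∈ P, w b) - ∑ b ∈ L, w b) * ((∑ b ∈ P', w b) - ∑ b ∈ K', w b)) := by
  -- inside the slot every trace is the set itself
  have eK : K ∩ V = K := Finset.inter_eq_left.2 (hKP.trans hPV)
  have eL : L ∩ V = L := Finset.inter_eq_left.2 (hLP.trans hPV)
  have eO : O ∩ V = O := Finset.inter_eq_left.2 (hOK.trans (hKP.trans hPV))
  have eK' : K' ∩ V = K' := Finset.inter_eq_left.2 (hKP'.trans hP'V)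
  have eL' : L' ∩ V = L' := Finset.inter_eq_left.2 (hLP'.trans hP'V)
  have eO' : O' ∩ V = O' := Finset.inter_eq_left.2 (hOK'.trans (hKP'.trans hP'V))
  have ePP' : (P ∩ P') ∩ V = P ∩ P' := Finset.inter_eq_left.2 (Finset.inter_subset_left.trans hPV)
  have eOO' : (O ∩ O') ∩ V = O ∩ O' := Finset.inter_eq_left.2 (Finset.inter_subset_left.trans (hOK.trans (hKP.trans hPV)))
  simp only [eK, eL, eO, eK', eL', eO', ePP', eOO'] at hpairK hpairL ⊢
  set v := ∑ b ∈ V, w b with hv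
  set p := ∑ b ∈ P, w b
  set o := ∑ b ∈ O, w b
  set k := ∑ b ∈ K, w b
  set l := ∑ b ∈ L, w b
  set p' := ∑ b ∈ P', w b
  set o' := ∑ b ∈ O', w b
  set k' := ∑ b ∈ K', w b
  set l' := ∑ b ∈ L', w b
  have hv1 : v ≤ 1 := by rw [hv, ← hw1]; exact sum_le_sum_of_subset' w hw (Finset.subset_univ V)
  have hok : o ≤ k := sum_le_sum_of_subset' w hw hOK
  have hol : o ≤ l := sum_le_sum_of_subset' w hw hOL
  have hkp : k ≤ p := sum_le_sum_of_subset' w hw hKP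
  have hlp : l ≤ p := sum_le_sum_of_subset' w hw hLP
  have hok' : o' ≤ k' := sum_le_sum_of_subset' w hw hOK'
  have hol' : o' ≤ l' := sum_le_sum_of_subset' w hw hOL'
  have hkp' : k' ≤ p' := sum_le_sum_of_subset' w hw hKP'
  have hlp' : l' ≤ p' := sum_le_sum_of_subset' w hw hLP'
  have hcore := fullSlot_core₂ p o k l p' o' k' l' (1 - v) hok hol hkp hlp hok' hol' hkp' hlp' (by linarith)
  have hC : 0 ≤ (1 - v) * ((∑ b ∈ P ∩ P', w b) - p * p') := mul_nonneg (by linarith) (by linarith)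
  nlinarith [hpairK, hpairL, hHarPP', hHarOO', hcore, hC]

/-- **Exchange lemma, general class, FULL SLOT, bracket 1.**  Same data; the bracket-1 exchange expression of
`…SahiE3ExchangeCross.exchange_of_noCross₁` is `≥ 0`. [this work] -/
theorem exchange_fullSlot₁ [Fintype B] (w R : B → ℝ) (hw : ∀ b, 0 ≤ w b) (hw1 : ∑ b, w b = 1)
    (V K L P O K' L' P' O' : Finset B)
    (hOK : O ⊆ K) (hOL : O ⊆ L) (hKP : K ⊆ P) (hLP : L ⊆ P) (hOK' : O' ⊆ K') (hOL' : O' ⊆ L') (hKP' : K' ⊆ P') (hLP' : L' ⊆ P')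
    (hPV : P ⊆ V) (hP'V : P' ⊆ V)
    (hpairK : (∑ b ∈ K, w b) * (∑ b ∈ K' ∩ V, w b) + (∑ b ∈ K', w b) * (∑ b ∈ K ∩ V, w b)
        - (∑ b ∈ V, w b) * (∑ b ∈ K, w b) * (∑ b ∈ K', w b) ≤ ∑ b ∈ (K ∩ K') ∩ V, R b)
    (hpairL : (∑ b ∈ L, w b) * (∑ b ∈ L' ∩ V, w b) + (∑ b ∈ L', w b) * (∑ b ∈ L ∩ V, w b)
        - (∑ b ∈ V, w b) * (∑ b ∈ L, w b) * (∑ b ∈ L', w b) ≤ ∑ b ∈ (L ∩ L') ∩ V, R b)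
    (hHarPP' : (∑ b ∈ P, w b) * (∑ b ∈ P', w b) ≤ ∑ b ∈ P ∩ P', w b)
    (hHarOO' : (∑ b ∈ O, w b) * (∑ b ∈ O', w b) ≤ ∑ b ∈ O ∩ O', w b) :
    0 ≤ (∑ b ∈ (P ∩ P') ∩ V, w b) + (∑ b ∈ (O ∩ O') ∩ V, w b)
        - (∑ b ∈ P, w b) * (∑ b ∈ O' ∩ V, w b) - (∑ b ∈ P', w b) * (∑ b ∈ O ∩ V, w b)
        + (∑ b ∈ (K ∩ K') ∩ V, R b) + (∑ b ∈ (L ∩ L') ∩ V, R b)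
        - ((∑ b ∈ K, w b) * (∑ b ∈ L' ∩ V, w b) + (∑ b ∈ L', w b) * (∑ b ∈ K ∩ V, w b)
            - (∑ b ∈ V, w b) * (∑ b ∈ K, w b) * (∑ b ∈ L', w b))
        - ((∑ b ∈ L, w b) * (∑ b ∈ K' ∩ V, w b) + (∑ b ∈ K', w b) * (∑ b ∈ L ∩ V, w b)
            - (∑ b ∈ V, w b) * (∑ b ∈ L, w b) * (∑ b ∈ K', w b))
        + (1 - ∑ b ∈ V, w b) * ((∑ b ∈ P ∩ P', w b) - (∑ b ∈ P, w b) * (∑ b ∈ P', w b)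
            + ((∑ b ∈ P, w b) - ∑ b ∈ K, w b) * ((∑ b ∈ K', w b) - ∑ b ∈ O', w b)
            + ((∑ b ∈ P, w b) - ∑ b ∈ O, w b) * ((∑ b ∈ P', w b) - ∑ b ∈ K', w b)) := by
  have eK : K ∩ V = K := Finset.inter_eq_left.2 (hKP.trans hPV)
  have eL : L ∩ V = L := Finset.inter_eq_left.2 (hLP.trans hPV)
  have eO : O ∩ V = O := Finset.inter_eq_left.2 (hOK.trans (hKP.trans hPV))
  have eK' : K' ∩ V = K' := Finset.inter_eq_left.2 (hKP'.trans hP'V)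
  have eL' : L' ∩ V = L' := Finset.inter_eq_left.2 (hLP'.trans hP'V)
  have eO' : O' ∩ V = O' := Finset.inter_eq_left.2 (hOK'.trans (hKP'.trans hP'V))
  have ePP' : (P ∩ P') ∩ V = P ∩ P' := Finset.inter_eq_left.2 (Finset.inter_subset_left.trans hPV)
  have eOO' : (O ∩ O') ∩ V = O ∩ O' := Finset.inter_eq_left.2 (Finset.inter_subset_left.trans (hOK.trans (hKP.trans hPV)))
  simp only [eK, eL, eO, eK', eL', eO', ePP', eOO'] at hpairK hpairL ⊢
  set v := ∑ b ∈ V, w b with hv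
  set p := ∑ b ∈ P, w b
  set o := ∑ b ∈ O, w b
  set k := ∑ b ∈ K, w b
  set l := ∑ b ∈ L, w b
  set p' := ∑ b ∈ P', w b
  set o' := ∑ b ∈ O', w b
  set k' := ∑ b ∈ K', w b
  set l' := ∑ b ∈ L', w b
  have hv1 : v ≤ 1 := by rw [hv, ← hw1]; exact sum_le_sum_of_subset' w hw (Finset.subset_univ V)
  have hok : o ≤ k := sum_le_sum_of_subset' w hw hOK
  have hol : o ≤ l := sum_le_sum_of_subset' w hw hOL
  have hkp : k ≤ p := sum_le_sum_of_subset' w hw hKP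
  have hlp : l ≤ p := sum_le_sum_of_subset' w hw hLP
  have hok' : o' ≤ k' := sum_le_sum_of_subset' w hw hOK'
  have hol' : o' ≤ l' := sum_le_sum_of_subset' w hw hOL'
  have hkp' : k' ≤ p' := sum_le_sum_of_subset' w hw hKP'
  have hlp' : l' ≤ p' := sum_le_sum_of_subset' w hw hLP'
  have hcore := fullSlot_core₁ p o k l p' o' k' l' (1 - v) hok hol hkp hlp hok' hol' hkp' hlp' (by linarith)
  have hC : 0 ≤ (1 - v) * ((∑ b ∈ P ∩ P', w b) - p * p') := mul_nonneg (by linarith) (by linarith)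
  nlinarith [hpairK, hpairL, hHarPP', hHarOO', hcore, hC]

end Summit.CriticalPhenomena.PercolationContinuityZ3.Theorems.SahiE3ExchangeFullSlot
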